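import Literature.Analysis.FluidPDE.FluidComputer.ThresholdLevelPass
import HarnessLib

/-!
# Fluid computer blueprint — threshold gate: the LEVEL STEP (crude pass, bootstrap, hitting time)

HONEST FRAMING: low prior, high value-of-information experiment on Tao's machine paradigm; NOT a
claim that NS blows up. Elementary interval bookkeeping for the 5-mode circuit
`thresholdCircuit ε σ ν μ r κ` on a forced window; nothing is asserted about any fluid equation.

## What this file is (bp3 gen 12)

One step of the trigger-level chain of the transfer stage: the state enters level `c = C` inside
an entry box `B : LevelEntry`; on the forced window of length `h` let `t*` be the maximal time
with `c ≤ C'` on `[0, t*]`. This file proves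

* `IsForcedWindow.crude_valid`: the CRUDE box `B.crudeBox G Rb h C C'` (pass 1 of
  `bookkeep_v6.step_w`: ball bounds only, signs of `a, c, d, ã` bootstrapped by continuous
  induction `nonneg_persist`) holds on `[0, t*]`, given its numerical side conditions
  `LevelEntry.CrudeSides`;
* `IsForcedWindow.iterate_refine_valid`: the `K`-fold refined box
  `(refine)^[K] (crudeBox)` holds on `[0, t*]` given the side conditions of every iterate;
* `IsForcedWindow.level_window`: if moreover the final trigger speed floor `ρℓ > 0` covers the
  level gap (`C' - C ≤ ρℓ h`), then the trigger REACHES `C'` at a time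
  `t* ∈ [(C' - C)/ρh, min ((C' - C)/ρℓ) h]` with the final box valid on `[0, t*]`.

The exit box at level `C'` and the composition-ready form of the step are in
`ThresholdLevelExit`. [cite: Tao2016AveragedNS, §5.5 Thm 5.3 (5.5)] for the circuit; everything
here is [folklore].
-/

noncomputable section

open Set Filter Topology
open scoped NNReal

namespace Literature.Analysis.FluidPDE.FluidComputer

open Literature.Analysis.FluidPDE.Tao2016AveragedNS Literature.Analysis.ODE

namespace LevelEntry

variable (G : GateData) (B : LevelEntry) (Rb h C C' : ℝ)

/-- **The crude box** (pass 1 of `bookkeep_v6.step_w`) on a sub-window of length `≤ h` from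
level `C` towards level `C'`, inside the mode ball of radius `Rb`: entry conduit box from the
residual box, then ball-only envelopes in the order clock → carrier ceiling → conduit ceiling →
carrier floor, trigger floor, conduit floor, output, and the residual box by interval algebra.
[folklore] -/
def crudeBox : WindowBox :=
  let dl0 := (B.wl + G.r * C * B.al) / (G.κ * B.zh)
  let dh0 := (B.wh + G.r * C * B.ah) / (G.κ * B.zl)
  let A1h := B.ah + (G.ε * Rb ^ 2 + G.μ * C' ^ 2 + G.δ) * h
  let D1h := dh0 + (G.r * A1h * C' + G.δ) * h
  let A1l := B.al - (G.ε * Rb ^ 2 + G.σ * Rb * C' + G.r * C' * D1h + G.δ) * h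
  let B1l := B.bl - (G.ν * C' ^ 2 + G.δ) * h
  let B1h := B.bh + (G.ε * Rb ^ 2 + G.δ) * h
  let c1l := C * (1 - (G.ν + G.μ) * Rb * h) - G.δ * h
  let D1l := dl0 * Real.exp (-(G.κ * Rb) * h) - G.δ * h
  let Z1l := B.zl - G.δ * h
  let Z1h := B.zh + (G.κ * D1h ^ 2 + G.δ) * h
  { Aℓ := A1l, Ah := A1h, Bℓ := B1l, Bh := B1h, cℓ := c1l, ch := C', Dℓ := D1l, Dh := D1h,
    Zℓ := Z1l, Zh := Z1h,
    Wℓ := G.κ * D1l * Z1l - G.r * C' * A1h, Wh := G.κ * D1h * Z1h - G.r * c1l * A1l }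

/-- Projections of the crude box (definitional). [folklore] -/
theorem crudeBox_Ah : (B.crudeBox G Rb h C C').Ah = B.ah + (G.ε * Rb ^ 2 + G.μ * C' ^ 2 + G.δ) * h :=
  rfl

/-- [folklore] -/
theorem crudeBox_Dh : (B.crudeBox G Rb h C C').Dh =
    (B.wh + G.r * C * B.ah) / (G.κ * B.zl) + (G.r * (B.crudeBox G Rb h C C').Ah * C' + G.δ) * h :=
  rfl

/-- [folklore] -/
theorem crudeBox_Aℓ : (B.crudeBox G Rb h C C').Aℓ =
    B.al - (G.ε * Rb ^ 2 + G.σ * Rb * C' + G.r * C' * (B.crudeBox G Rb h C C').Dh + G.δ) * h :=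
  rfl

/-- [folklore] -/
theorem crudeBox_Bℓ : (B.crudeBox G Rb h C C').Bℓ = B.bl - (G.ν * C' ^ 2 + G.δ) * h := rfl

/-- [folklore] -/
theorem crudeBox_Bh : (B.crudeBox G Rb h C C').Bh = B.bh + (G.ε * Rb ^ 2 + G.δ) * h := rfl

/-- [folklore] -/
theorem crudeBox_cℓ : (B.crudeBox G Rb h C C').cℓ = C * (1 - (G.ν + G.μ) * Rb * h) - G.δ * h :=
  rfl

/-- [folklore] -/
theorem crudeBox_ch : (B.crudeBox G Rb h C C').ch = C' := rfl

/-- [folklore] -/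
theorem crudeBox_Dℓ : (B.crudeBox G Rb h C C').Dℓ =
    (B.wl + G.r * C * B.al) / (G.κ * B.zh) * Real.exp (-(G.κ * Rb) * h) - G.δ * h := rfl

/-- [folklore] -/
theorem crudeBox_Zℓ : (B.crudeBox G Rb h C C').Zℓ = B.zl - G.δ * h := rfl

/-- [folklore] -/
theorem crudeBox_Zh : (B.crudeBox G Rb h C C').Zh =
    B.zh + (G.κ * (B.crudeBox G Rb h C C').Dh ^ 2 + G.δ) * h := rfl

/-- [folklore] -/
theorem crudeBox_Wℓ : (B.crudeBox G Rb h C C').Wℓ =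
    G.κ * (B.crudeBox G Rb h C C').Dℓ * (B.crudeBox G Rb h C C').Zℓ -
      G.r * C' * (B.crudeBox G Rb h C C').Ah := rfl

/-- [folklore] -/
theorem crudeBox_Wh : (B.crudeBox G Rb h C C').Wh =
    G.κ * (B.crudeBox G Rb h C C').Dh * (B.crudeBox G Rb h C C').Zh -
      G.r * (B.crudeBox G Rb h C C').cℓ * (B.crudeBox G Rb h C C').Aℓ := rfl

/-- **Numerical side conditions of the crude pass** (the checks of `bookkeep_v6.step_w`,
pass 1): level data, positive entry carrier and output floors, nonnegative entry conduit
numerator, and positive crude floors of carrier, clock, trigger, conduit and output. [folklore] -/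
structure CrudeSides : Prop where
  hC : 0 < C
  hCC' : C ≤ C'
  hal : 0 < B.al
  hzl : 0 < B.zl
  hw0 : 0 ≤ B.wl + G.r * C * B.al
  hA : 0 < (B.crudeBox G Rb h C C').Aℓ
  hB : 0 < (B.crudeBox G Rb h C C').Bℓ
  hc : 0 < (B.crudeBox G Rb h C C').cℓ
  hD : 0 < (B.crudeBox G Rb h C C').Dℓ
  hZ : 0 < (B.crudeBox G Rb h C C').Zℓ

/-- **The level box after `K` refinement passes**: `refine^[K] (crudeBox)`. [folklore] -/
def levelBox (K : ℕ) : WindowBox :=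
  (fun S : WindowBox => S.refine G B h C C')^[K] (B.crudeBox G Rb h C C')

/-- [folklore] -/
theorem levelBox_zero : B.levelBox G Rb h C C' 0 = B.crudeBox G Rb h C C' := rfl

/-- [folklore] -/
theorem levelBox_succ (K : ℕ) :
    B.levelBox G Rb h C C' (K + 1) = (B.levelBox G Rb h C C' K).refine G B h C C' := by
  simp only [levelBox]
  exact Function.iterate_succ_apply' _ _ _

/-- **A PASS CHAIN** of length `K`: boxes `S 0, …, S K` with `S 0 ⊇ crudeBox` and
`S (j+1) ⊇ refine (S j)` as sets of states. The exact recursion `levelBox` is a pass chain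
(`passChain_levelBox`); a numerical instance may instead list rational boxes rounded outward from
certified brackets of the exponentials — the theorems below only use the containments.
[folklore] -/
structure PassChain (K : ℕ) (S : ℕ → WindowBox) : Prop where
  zero : ∀ X : Fin 5 → ℝ, (B.crudeBox G Rb h C C').mem G.κ G.r X → (S 0).mem G.κ G.r X
  succ : ∀ j < K, ∀ X : Fin 5 → ℝ,
    ((S j).refine G B h C C').mem G.κ G.r X → (S (j + 1)).mem G.κ G.r X

/-- The exact recursion is a pass chain. [folklore] -/
theorem passChain_levelBox (K : ℕ) : B.PassChain G Rb h C C' K (B.levelBox G Rb h C C') :=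
  ⟨fun X hX => by simpa only [levelBox_zero] using hX,
    fun j _ X hX => by rw [levelBox_succ]; exact hX⟩

/-- Rational lower bracket of the crude conduit floor: `e^{-y} ≥ 1 - y`, so
`dl0·(1 - κ·Rb·h) - δ·h ≤ (crudeBox).Dℓ` whenever the entry conduit floor `dl0` is nonnegative.
[folklore] -/
theorem crudeBox_Dℓ_ge (hdl0 : 0 ≤ (B.wl + G.r * C * B.al) / (G.κ * B.zh)) :
    (B.wl + G.r * C * B.al) / (G.κ * B.zh) * (1 - G.κ * Rb * h) - G.δ * h ≤
      (B.crudeBox G Rb h C C').Dℓ := by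
  rw [crudeBox_Dℓ]
  have hexp : 1 - G.κ * Rb * h ≤ Real.exp (-(G.κ * Rb) * h) := by
    have := Real.add_one_le_exp (-(G.κ * Rb) * h)
    linarith
  have := mul_le_mul_of_nonneg_left hexp hdl0
  linarith

end LevelEntry

/-! ### Refinement only shrinks boxes: side conditions and trigger speed are monotone

These lemmas let a numerical instance check the side conditions `Sides` on the CRUDE box only
(`LevelEntry.levelBox_sides`) and the reach condition at any pass `j ≤ K`
(`LevelEntry.levelBox_ρℓ_mono`). -/

namespace WindowBox

variable {G : GateData}

/-- Every floor of `S.refine …` is at least the floor of `S`, every ceiling at most the ceiling of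
`S` (the refinement intersects with `S`). [folklore] -/
theorem refine_shrinks (S : WindowBox) (B : LevelEntry) (h C C' : ℝ) :
    S.Aℓ ≤ (S.refine G B h C C').Aℓ ∧ (S.refine G B h C C').Ah ≤ S.Ah ∧
    S.Bℓ ≤ (S.refine G B h C C').Bℓ ∧ (S.refine G B h C C').Bh ≤ S.Bh ∧
    S.cℓ ≤ (S.refine G B h C C').cℓ ∧ (S.refine G B h C C').ch = C' ∧
    S.Dℓ ≤ (S.refine G B h C C').Dℓ ∧ (S.refine G B h C C').Dh ≤ S.Dh ∧
    S.Zℓ ≤ (S.refine G B h C C').Zℓ ∧ (S.refine G B h C C').Zh ≤ S.Zh ∧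
    S.Wℓ ≤ (S.refine G B h C C').Wℓ ∧ (S.refine G B h C C').Wh ≤ S.Wh :=
  ⟨le_max_left _ _, min_le_left _ _, le_max_left _ _, min_le_left _ _, le_max_left _ _, rfl,
    le_max_left _ _, min_le_left _ _, le_max_left _ _, min_le_left _ _, le_max_left _ _,
    min_le_left _ _⟩

/-- **Side conditions survive refinement** (nonnegative gate constants): `Sides S → Sides
(S.refine …)`, because refinement raises floors and lowers ceilings, so `gℓ = νBℓ - μAh` and
`ρℓ = σAℓ² + gℓcℓ - δ` can only grow. [folklore] -/
theorem Sides.refine (hG : G.Valid) {S : WindowBox} (hS : S.Sides G) (B : LevelEntry)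
    (h C C' : ℝ) : (S.refine G B h C C').Sides G := by
  obtain ⟨hA, hAh, hB, -, hc, -, hD, -, hZ, -, -, -⟩ := S.refine_shrinks (G := G) B h C C'
  have hg' : G.ν * S.Bℓ - G.μ * S.Ah ≤
      G.ν * (S.refine G B h C C').Bℓ - G.μ * (S.refine G B h C C').Ah := by
    have h1 := mul_le_mul_of_nonneg_left hB hG.hν
    have h2 := mul_le_mul_of_nonneg_left hAh hG.hμ
    linarith
  have hA0 : 0 ≤ (S.refine G B h C C').Aℓ := hS.hA.trans hA
  have hc0 : 0 ≤ (S.refine G B h C C').cℓ := hS.hc.trans hc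
  have hg0 : 0 ≤ G.ν * (S.refine G B h C C').Bℓ - G.μ * (S.refine G B h C C').Ah :=
    hS.hg.trans hg'
  refine ⟨hA0, hS.hB.trans hB, hc0, hS.hD.trans hD, hS.hZ.trans_le hZ, hg0, ?_⟩
  have hsq : S.Aℓ ^ 2 ≤ (S.refine G B h C C').Aℓ ^ 2 := pow_le_pow_left₀ hS.hA hA 2
  have h3 := mul_le_mul_of_nonneg_left hsq hG.hσ
  have h4 : (G.ν * S.Bℓ - G.μ * S.Ah) * S.cℓ ≤
      (G.ν * (S.refine G B h C C').Bℓ - G.μ * (S.refine G B h C C').Ah) *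
        (S.refine G B h C C').cℓ := mul_le_mul hg' hc hS.hc hg0
  linarith [hS.hρ]

/-- The trigger speed floor `ρℓ` can only grow under refinement. [folklore] -/
theorem ρℓ_refine_ge (hG : G.Valid) {S : WindowBox} (hS : S.Sides G) (B : LevelEntry)
    (h C C' : ℝ) : S.ρℓ G ≤ (S.refine G B h C C').ρℓ G := by
  obtain ⟨hA, hAh, hB, -, hc, -, -, -, -, -, -, -⟩ := S.refine_shrinks (G := G) B h C C'
  have hg' : G.ν * S.Bℓ - G.μ * S.Ah ≤
      G.ν * (S.refine G B h C C').Bℓ - G.μ * (S.refine G B h C C').Ah := by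
    have h1 := mul_le_mul_of_nonneg_left hB hG.hν
    have h2 := mul_le_mul_of_nonneg_left hAh hG.hμ
    linarith
  have hg0 : 0 ≤ G.ν * (S.refine G B h C C').Bℓ - G.μ * (S.refine G B h C C').Ah :=
    hS.hg.trans hg'
  have hsq : S.Aℓ ^ 2 ≤ (S.refine G B h C C').Aℓ ^ 2 := pow_le_pow_left₀ hS.hA hA 2
  have h3 := mul_le_mul_of_nonneg_left hsq hG.hσ
  have h4 : (G.ν * S.Bℓ - G.μ * S.Ah) * S.cℓ ≤
      (G.ν * (S.refine G B h C C').Bℓ - G.μ * (S.refine G B h C C').Ah) *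
        (S.refine G B h C C').cℓ := mul_le_mul hg' hc hS.hc hg0
  simp only [WindowBox.ρℓ, WindowBox.gℓ]
  linarith

end WindowBox

namespace LevelEntry

variable {G : GateData}

/-- **Side conditions of every level box from those of the crude box.** [folklore] -/
theorem levelBox_sides (hG : G.Valid) (B : LevelEntry) (Rb h C C' : ℝ)
    (h0 : (B.crudeBox G Rb h C C').Sides G) : ∀ j, (B.levelBox G Rb h C C' j).Sides G
  | 0 => by simpa only [levelBox_zero] using h0
  | j + 1 => by
    rw [levelBox_succ]
    exact (levelBox_sides hG B Rb h C C' h0 j).refine hG B h C C'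

/-- **The trigger speed floor of the level boxes is nondecreasing in the pass count.**
[folklore] -/
theorem levelBox_ρℓ_mono (hG : G.Valid) (B : LevelEntry) (Rb h C C' : ℝ)
    (h0 : (B.crudeBox G Rb h C C').Sides G) {j K : ℕ} (hjK : j ≤ K) :
    (B.levelBox G Rb h C C' j).ρℓ G ≤ (B.levelBox G Rb h C C' K).ρℓ G := by
  induction K with
  | zero =>
    obtain rfl : j = 0 := Nat.le_zero.mp hjK
    exact le_rfl
  | succ K ih =>
    rcases Nat.lt_or_eq_of_le hjK with hlt | rfl
    · rw [levelBox_succ]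
      exact (ih (Nat.lt_succ_iff.mp hlt)).trans
        (WindowBox.ρℓ_refine_ge hG (levelBox_sides hG B Rb h C C' h0 K) B h C C')
    · exact le_rfl

end LevelEntry

/-- `coef * t ≤ coef * h` for `0 ≤ coef` and `t ≤ h`. [folklore] -/
theorem mul_le_mul_coef {coef t h : ℝ} (hc : 0 ≤ coef) (hth : t ≤ h) :
    coef * t ≤ coef * h := mul_le_mul_of_nonneg_left hth hc

namespace IsForcedWindow

variable {G : GateData} {τ : ℝ} {x : ℝ → Fin 5 → ℝ}

/-- **Entry conduit box** from the entry residual / carrier / output boxes at level `C`: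
`dl0 = (wl + rC·al)/(κ zh) ≤ d(0) ≤ dh0 = (wh + rC·ah)/(κ zl)`. [folklore] -/
theorem entry_conduit (hG : G.Valid) {C : ℝ} {B : LevelEntry} {X : Fin 5 → ℝ}
    (hB : B.mem G.κ G.r C X) (hC : 0 ≤ C) (hal : 0 ≤ B.al) (hzl : 0 < B.zl)
    (hw0 : 0 ≤ B.wl + G.r * C * B.al) :
    (B.wl + G.r * C * B.al) / (G.κ * B.zh) ≤ X 3 ∧ X 3 ≤ (B.wh + G.r * C * B.ah) / (G.κ * B.zl) := by
  obtain ⟨-, -, -, -, hr, hκ, -⟩ := hG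
  obtain ⟨⟨hal', hah⟩, -, hcC, hw, ⟨hzl', hzh⟩, -⟩ := hB
  have hc : C ≤ X 2 ∧ X 2 ≤ C := ⟨hcC.symm.le, hcC.le⟩
  have hdd := conduit_bounds_of_slavingResidual hr hκ hal hC hzl ⟨hal', hah⟩ hc ⟨hzl', hzh⟩ hw
  have hzlh : B.zl ≤ B.zh := hzl'.trans hzh
  have hκzl : 0 < G.κ * B.zl := mul_pos hκ hzl
  have hmon : G.κ * B.zl ≤ G.κ * B.zh := mul_le_mul_of_nonneg_left hzlh hκ.le
  have hnumh : 0 ≤ B.wh + G.r * C * B.ah := by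
    have h1 := mul_le_mul_of_nonneg_left (hal'.trans hah) (mul_nonneg hr hC)
    linarith [hw.1, hw.2]
  constructor
  · have hmin : min ((B.wl + G.r * C * B.al) / (G.κ * B.zh)) ((B.wl + G.r * C * B.al) /
        (G.κ * B.zl)) = (B.wl + G.r * C * B.al) / (G.κ * B.zh) :=
      min_eq_left (div_le_div_of_nonneg_left hw0 hκzl hmon)
    rw [← hmin]; exact hdd.1
  · have hmax : max ((B.wh + G.r * C * B.ah) / (G.κ * B.zl)) ((B.wh + G.r * C * B.ah) /
        (G.κ * B.zh)) = (B.wh + G.r * C * B.ah) / (G.κ * B.zl) :=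
      max_eq_left (div_le_div_of_nonneg_left hnumh hκzl hmon)
    rw [← hmax]; exact hdd.2

/-- **Crude bounds from signs.** On a forced window `[0, τ]` with `τ ≤ h`, inside the ball of
radius `Rb`, with the trigger `≤ C'` on `[0, τ]` and `a, c, d, ã ≥ 0` on `[0, τ)`: the crude
box holds for `a, b, c, d, ã` at every time of `[0, τ]`. [folklore] -/
theorem crude_of_signs (hG : G.Valid) (hW : IsForcedWindow G.ε G.σ G.ν G.μ G.r G.κ G.δ τ x)
    {Rb h C C' : ℝ} {B : LevelEntry} (hτh : τ ≤ h) (hRb : 0 ≤ Rb)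
    (hball : ∀ t ∈ Ico 0 τ, ∀ i, |x t i| ≤ Rb) (hB : B.mem G.κ G.r C (x 0))
    (hcs : B.CrudeSides G Rb h C C') (hpre : ∀ t ∈ Icc 0 τ, x t 2 ≤ C')
    (hsg : ∀ t ∈ Ico 0 τ, 0 ≤ x t 0 ∧ 0 ≤ x t 2 ∧ 0 ≤ x t 3 ∧ 0 ≤ x t 4) :
    ∀ t ∈ Icc 0 τ,
      ((B.crudeBox G Rb h C C').Aℓ ≤ x t 0 ∧ x t 0 ≤ (B.crudeBox G Rb h C C').Ah) ∧
      ((B.crudeBox G Rb h C C').Bℓ ≤ x t 1 ∧ x t 1 ≤ (B.crudeBox G Rb h C C').Bh) ∧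
      ((B.crudeBox G Rb h C C').cℓ ≤ x t 2 ∧ x t 2 ≤ (B.crudeBox G Rb h C C').ch) ∧
      ((B.crudeBox G Rb h C C').Dℓ ≤ x t 3 ∧ x t 3 ≤ (B.crudeBox G Rb h C C').Dh) ∧
      ((B.crudeBox G Rb h C C').Zℓ ≤ x t 4 ∧ x t 4 ≤ (B.crudeBox G Rb h C C').Zh) := by
  intro t ht
  obtain ⟨hε, hσ, hν, hμ, hr, hκ, hδ⟩ := id hG
  obtain ⟨hC, hCC', hal0, hzl, hw0, hA1, hB1, hc1, hD1, hZ1⟩ := hcs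
  obtain ⟨⟨hal, hah⟩, ⟨hbl, hbh⟩, hcC, hw, ⟨hzl0, hzh0⟩, -⟩ := id hB
  have hh : 0 ≤ h := ht.1.trans (ht.2.trans hτh)
  have hC' : 0 ≤ C' := hC.le.trans hCC'
  have sub : ∀ s ∈ Ico 0 τ, s ∈ Icc 0 τ := fun s hs => Ico_subset_Icc_self hs
  have ha0 : ∀ s ∈ Ico 0 τ, 0 ≤ x s 0 := fun s hs => (hsg s hs).1
  have hc0 : ∀ s ∈ Ico 0 τ, 0 ≤ x s 2 := fun s hs => (hsg s hs).2.1
  have hd0 : ∀ s ∈ Ico 0 τ, 0 ≤ x s 3 := fun s hs => (hsg s hs).2.2.1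
  have hz0 : ∀ s ∈ Ico 0 τ, 0 ≤ x s 4 := fun s hs => (hsg s hs).2.2.2
  have haRb : ∀ s ∈ Ico 0 τ, 0 ≤ x s 0 ∧ x s 0 ≤ Rb :=
    fun s hs => ⟨ha0 s hs, (abs_le.1 (hball s hs 0)).2⟩
  have hcC' : ∀ s ∈ Ico 0 τ, 0 ≤ x s 2 ∧ x s 2 ≤ C' := fun s hs => ⟨hc0 s hs, hpre s (sub s hs)⟩
  -- entry conduit
  have hd00 := entry_conduit hG hB hC.le hal0.le hzl hw0
  have hdl0 : 0 < (B.wl + G.r * C * B.al) / (G.κ * B.zh) := by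
    rw [LevelEntry.crudeBox_Dℓ] at hD1
    by_contra hneg
    push Not at hneg
    have := mul_nonpos_of_nonpos_of_nonneg hneg (Real.exp_pos (-(G.κ * Rb) * h)).le
    have := mul_nonneg hδ hh
    linarith
  have hd0pos : 0 < x 0 3 := hdl0.trans_le hd00.1
  -- name the crude box and record its defining equations
  obtain ⟨S, hSdef⟩ : ∃ S : WindowBox, S = B.crudeBox G Rb h C C' := ⟨_, rfl⟩
  have eAh : S.Ah = B.ah + (G.ε * Rb ^ 2 + G.μ * C' ^ 2 + G.δ) * h := by
    rw [hSdef]; exact LevelEntry.crudeBox_Ah G B Rb h C C'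
  have eDh : S.Dh = (B.wh + G.r * C * B.ah) / (G.κ * B.zl) + (G.r * S.Ah * C' + G.δ) * h := by
    rw [hSdef]; exact LevelEntry.crudeBox_Dh G B Rb h C C'
  have eAℓ : S.Aℓ =
      B.al - (G.ε * Rb ^ 2 + G.σ * Rb * C' + G.r * C' * S.Dh + G.δ) * h := by
    rw [hSdef]; exact LevelEntry.crudeBox_Aℓ G B Rb h C C'
  have eBℓ : S.Bℓ = B.bl - (G.ν * C' ^ 2 + G.δ) * h := by
    rw [hSdef]; exact LevelEntry.crudeBox_Bℓ G B Rb h C C'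
  have eBh : S.Bh = B.bh + (G.ε * Rb ^ 2 + G.δ) * h := by
    rw [hSdef]; exact LevelEntry.crudeBox_Bh G B Rb h C C'
  have ecℓ : S.cℓ = C * (1 - (G.ν + G.μ) * Rb * h) - G.δ * h := by
    rw [hSdef]; exact LevelEntry.crudeBox_cℓ G B Rb h C C'
  have ech : S.ch = C' := by rw [hSdef]; exact LevelEntry.crudeBox_ch G B Rb h C C'
  have eDℓ : S.Dℓ =
      (B.wl + G.r * C * B.al) / (G.κ * B.zh) * Real.exp (-(G.κ * Rb) * h) - G.δ * h := by
    rw [hSdef]; exact LevelEntry.crudeBox_Dℓ G B Rb h C C'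
  have eZℓ : S.Zℓ = B.zl - G.δ * h := by rw [hSdef]; exact LevelEntry.crudeBox_Zℓ G B Rb h C C'
  have eZh : S.Zh = B.zh + (G.κ * S.Dh ^ 2 + G.δ) * h := by
    rw [hSdef]; exact LevelEntry.crudeBox_Zh G B Rb h C C'
  rw [← hSdef] at hA1 hB1 hc1 hD1 hZ1 ⊢
  -- clock
  have hclk := hW.clock_two_sided_lin hε hν (le_refl (0 : ℝ)) (le_refl (0 : ℝ)) haRb hcC'
  have hBl : ∀ s ∈ Icc 0 τ, S.Bℓ ≤ x s 1 := by
    intro s hs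
    rw [eBℓ]
    have h1 := (hclk s hs).1
    have h2 := mul_le_mul_coef (coef := G.ν * C' ^ 2 + G.δ) (by positivity) (hs.2.trans hτh)
    linarith [h1, h2, hbl]
  have hBh : ∀ s ∈ Icc 0 τ, x s 1 ≤ S.Bh := by
    intro s hs
    rw [eBh]
    have h1 := (hclk s hs).2
    have h2 := mul_le_mul_coef (coef := G.ε * Rb ^ 2 + G.δ) (by positivity) (hs.2.trans hτh)
    linarith [h1, h2, hbh]
  have hb0 : ∀ s ∈ Ico 0 τ, 0 ≤ x s 1 := fun s hs => hB1.le.trans (hBl s (sub s hs))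
  -- carrier ceiling
  have hAc := hW.carrier_le_affine hε hσ hμ hr (Cm := C') ha0 hb0 hcC' hd0
  have hAh : ∀ s ∈ Icc 0 τ, x s 0 ≤ S.Ah := by
    intro s hs
    rw [eAh]
    have h1 := hAc s hs
    have h2 := mul_le_mul_coef (coef := G.μ * C' ^ 2 + G.δ) (by positivity) (hs.2.trans hτh)
    have h3 : 0 ≤ G.ε * Rb ^ 2 * h := by positivity
    linarith [h1, h2, h3, hah]
  have hAhpos : 0 < S.Ah := (hal0.trans_le hal).trans_le (hAh 0 ⟨le_rfl, ht.1.trans ht.2⟩)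
  -- conduit ceiling
  have hDc := hW.conduit_le_lin hr hκ.le (Ah := S.Ah) (Ch := C')
    (fun s hs => ⟨ha0 s hs, hAh s (sub s hs)⟩) hcC' hd0 hz0
  have hDh : ∀ s ∈ Icc 0 τ, x s 3 ≤ S.Dh := by
    intro s hs
    rw [eDh]
    have h1 := hDc s hs
    have hcoef : 0 ≤ G.r * S.Ah * C' + G.δ := by positivity
    have h2 := mul_le_mul_coef hcoef (hs.2.trans hτh)
    linarith [hd00.2]
  have hDhpos : 0 < S.Dh := hd0pos.trans_le (hDh 0 ⟨le_rfl, ht.1.trans ht.2⟩)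
  -- carrier floor
  have hAf := hW.carrier_ge_crude hε hσ hμ hr (R := Rb) (Ch := C') (Dh := S.Dh) hball ha0 hcC'
    (fun s hs => hDh s (sub s hs))
  have hAl : ∀ s ∈ Icc 0 τ, S.Aℓ ≤ x s 0 := by
    intro s hs
    rw [eAℓ]
    have h1 := hAf s hs
    rw [max_eq_left hDhpos.le] at h1
    have hcoef : 0 ≤ G.ε * Rb ^ 2 + G.σ * Rb * C' + G.r * C' * S.Dh + G.δ := by positivity
    have h2 := mul_le_mul_coef hcoef (hs.2.trans hτh)
    linarith
  -- trigger floor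
  have hc00 : 0 ≤ x 0 2 := by rw [hcC]; exact hC.le
  have hcf := hW.trigger_ge_crude hσ hν hμ hδ hRb hball hc00 hc0
  have hcl : ∀ s ∈ Icc 0 τ, S.cℓ ≤ x s 2 := by
    intro s hs
    rw [ecℓ]
    have h1 := hcf s hs
    rw [hcC] at h1
    have hcoef : 0 ≤ C * ((G.ν + G.μ) * Rb) + G.δ := by positivity
    have h2 := mul_le_mul_coef hcoef (hs.2.trans hτh)
    linarith [h1, h2]
  -- conduit floor
  have hdf := hW.conduit_ge_crude hr hκ.le hδ hRb (fun s hs => hball s hs 4) ha0 hc0 hd0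
  have hDl : ∀ s ∈ Icc 0 τ, S.Dℓ ≤ x s 3 := by
    intro s hs
    rw [eDℓ]
    have h1 := hdf s hs
    have hexp : Real.exp (-(G.κ * Rb) * h) ≤ Real.exp (-(G.κ * Rb) * s) := by
      apply Real.exp_le_exp.2
      have := mul_le_mul_coef (coef := G.κ * Rb) (by positivity) (hs.2.trans hτh)
      linarith
    have h2 : (B.wl + G.r * C * B.al) / (G.κ * B.zh) * Real.exp (-(G.κ * Rb) * h) ≤
        x 0 3 * Real.exp (-(G.κ * Rb) * s) :=
      (mul_le_mul_of_nonneg_left hexp hdl0.le).trans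
        (mul_le_mul_of_nonneg_right hd00.1 (Real.exp_pos _).le)
    have h3 := mul_le_mul_coef hδ (hs.2.trans hτh)
    linarith
  -- output
  have hzz := hW.output_two_sided_lin hκ.le (Dℓ := 0) (Dh := S.Dh) le_rfl
    (fun s hs => ⟨hd0 s hs, hDh s (sub s hs)⟩)
  have hZl : ∀ s ∈ Icc 0 τ, S.Zℓ ≤ x s 4 := by
    intro s hs
    rw [eZℓ]
    have h1 := (hzz s hs).1
    have h3 := mul_le_mul_coef hδ (hs.2.trans hτh)
    linarith [h1, h3, hzl0]
  have hZh : ∀ s ∈ Icc 0 τ, x s 4 ≤ S.Zh := by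
    intro s hs
    rw [eZh]
    have h1 := (hzz s hs).2
    have hcoef : 0 ≤ G.κ * S.Dh ^ 2 + G.δ := by positivity
    have h2 := mul_le_mul_coef hcoef (hs.2.trans hτh)
    linarith
  refine ⟨⟨hAl t ht, hAh t ht⟩, ⟨hBl t ht, hBh t ht⟩, ⟨hcl t ht, ?_⟩, ⟨hDl t ht, hDh t ht⟩,
    ⟨hZl t ht, hZh t ht⟩⟩
  rw [ech]; exact hpre t ht

/-- **VALIDITY OF THE CRUDE BOX.** On a forced window `[0, τ]` with `0 ≤ τ ≤ h`, inside the
ball of radius `Rb`, with the trigger `≤ C'` on `[0, τ]`: the crude box holds at every time of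
`[0, τ]`; the signs of `a, c, d, ã` are bootstrapped by continuous induction. [folklore] -/
theorem crude_valid (hG : G.Valid) (hW : IsForcedWindow G.ε G.σ G.ν G.μ G.r G.κ G.δ τ x)
    {Rb h C C' : ℝ} {B : LevelEntry} (hτ : 0 ≤ τ) (hτh : τ ≤ h) (hRb : 0 ≤ Rb)
    (hball : ∀ t ∈ Ico 0 τ, ∀ i, |x t i| ≤ Rb) (hB : B.mem G.κ G.r C (x 0))
    (hcs : B.CrudeSides G Rb h C C') (hpre : ∀ t ∈ Icc 0 τ, x t 2 ≤ C') :
    ∀ t ∈ Icc 0 τ, (B.crudeBox G Rb h C C').mem G.κ G.r (x t) := by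
  obtain ⟨hε, hσ, hν, hμ, hr, hκ, hδ⟩ := id hG
  obtain ⟨hC, hCC', hal0, hzl, hw0, hA1, hB1, hc1, hD1, hZ1⟩ := id hcs
  obtain ⟨⟨hal, hah⟩, -, hcC, hw, ⟨hzl0, hzh0⟩, -⟩ := id hB
  have hh : 0 ≤ h := hτ.trans hτh
  -- entry positivity
  have hd00 := entry_conduit hG hB hC.le hal0.le hzl hw0
  have hdl0 : 0 < (B.wl + G.r * C * B.al) / (G.κ * B.zh) := by
    have hD1' := hD1
    rw [LevelEntry.crudeBox_Dℓ] at hD1'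
    by_contra hneg
    push Not at hneg
    have := mul_nonpos_of_nonpos_of_nonneg hneg (Real.exp_pos (-(G.κ * Rb) * h)).le
    have := mul_nonneg hδ hh
    linarith
  have ha0pos : 0 < x 0 0 := hal0.trans_le hal
  have hc0pos : 0 < x 0 2 := by rw [hcC]; exact hC
  have hd0pos : 0 < x 0 3 := hdl0.trans_le hd00.1
  have hz0pos : 0 < x 0 4 := hzl.trans_le hzl0
  -- bootstrap of the signs of `a, c, d, ã`
  set P : Set (Fin 5) := {1}ᶜ with hPdef
  have m0 : (0 : Fin 5) ∈ P := by simp [hPdef]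
  have m2 : (2 : Fin 5) ∈ P := by simp [hPdef]
  have m3 : (3 : Fin 5) ∈ P := by simp [hPdef]
  have m4 : (4 : Fin 5) ∈ P := by simp [hPdef]
  have h0 : ∀ i ∈ P, 0 < x 0 i := by
    intro i hi
    fin_cases i
    · exact ha0pos
    · simp [hPdef] at hi
    · exact hc0pos
    · exact hd0pos
    · exact hz0pos
  have hstep : ∀ s ∈ Icc 0 τ, (∀ t ∈ Icc 0 s, ∀ i ∈ P, 0 ≤ x t i) → ∀ i ∈ P, 0 < x s i := by
    intro s hs hnn
    have hsg : ∀ t ∈ Ico 0 s, 0 ≤ x t 0 ∧ 0 ≤ x t 2 ∧ 0 ≤ x t 3 ∧ 0 ≤ x t 4 := fun t ht =>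
      ⟨hnn t (Ico_subset_Icc_self ht) 0 m0, hnn t (Ico_subset_Icc_self ht) 2 m2,
        hnn t (Ico_subset_Icc_self ht) 3 m3, hnn t (Ico_subset_Icc_self ht) 4 m4⟩
    have hb := crude_of_signs hG (hW.mono hs.2) (hs.2.trans hτh) hRb
      (fun t ht => hball t ⟨ht.1, ht.2.trans_le hs.2⟩) hB hcs
      (fun t ht => hpre t ⟨ht.1, ht.2.trans hs.2⟩) hsg s ⟨hs.1, le_rfl⟩
    obtain ⟨⟨haℓ, -⟩, -, ⟨hcℓ, -⟩, ⟨hdℓ, -⟩, ⟨hzℓ, -⟩⟩ := hb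
    intro i hi
    fin_cases i
    · exact hA1.trans_le haℓ
    · simp [hPdef] at hi
    · exact hc1.trans_le hcℓ
    · exact hD1.trans_le hdℓ
    · exact hZ1.trans_le hzℓ
  have hnn := nonneg_persist hW.continuousOn hτ P h0 hstep
  have hsg : ∀ t ∈ Ico 0 τ, 0 ≤ x t 0 ∧ 0 ≤ x t 2 ∧ 0 ≤ x t 3 ∧ 0 ≤ x t 4 := fun t ht =>
    ⟨hnn t (Ico_subset_Icc_self ht) 0 m0, hnn t (Ico_subset_Icc_self ht) 2 m2,
      hnn t (Ico_subset_Icc_self ht) 3 m3, hnn t (Ico_subset_Icc_self ht) 4 m4⟩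
  have hb := crude_of_signs hG hW hτh hRb hball hB hcs hpre hsg
  intro t ht
  obtain ⟨ha, hbb, hc, hd, hz⟩ := hb t ht
  have hwb := slavingResidual_mem_of_box hr hκ.le hA1.le hc1.le hD1.le hZ1.le ha hc hd hz
  refine ⟨ha, hbb, hc, hd, hz, ?_⟩
  rw [LevelEntry.crudeBox_Wℓ, LevelEntry.crudeBox_Wh]
  simpa only [LevelEntry.crudeBox_ch] using hwb

/-- **Validity of the iterated refinement.** [folklore] -/
theorem iterate_refine_valid (hG : G.Valid) (hW : IsForcedWindow G.ε G.σ G.ν G.μ G.r G.κ G.δ τ x)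
    {Rb h C C' : ℝ} {B : LevelEntry} (hτh : τ ≤ h) (hB : B.mem G.κ G.r C (x 0))
    (hpre : ∀ t ∈ Icc 0 τ, x t 2 ≤ C')
    (h0 : ∀ t ∈ Icc 0 τ, (B.crudeBox G Rb h C C').mem G.κ G.r (x t)) (K : ℕ)
    (hsides : ∀ j < K, (B.levelBox G Rb h C C' j).Sides G) :
    ∀ t ∈ Icc 0 τ, (B.levelBox G Rb h C C' K).mem G.κ G.r (x t) := by
  induction K with
  | zero => simpa only [LevelEntry.levelBox_zero] using h0
  | succ K ih =>
    have hK := ih fun j hj => hsides j (hj.trans (Nat.lt_succ_self K))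
    rw [LevelEntry.levelBox_succ]
    exact hW.refine_valid hG hτh hK (hsides K (Nat.lt_succ_self K)) hB hpre

/-- **Validity along a pass chain**: if the crude box holds on `[0, τ]` and the side conditions
of `S 0, …, S (K-1)` hold, then every `S j`, `j ≤ K`, holds on `[0, τ]`. [folklore] -/
theorem chain_valid (hG : G.Valid) (hW : IsForcedWindow G.ε G.σ G.ν G.μ G.r G.κ G.δ τ x)
    {Rb h C C' : ℝ} {B : LevelEntry} {K : ℕ} {S : ℕ → WindowBox} (hτh : τ ≤ h)
    (hB : B.mem G.κ G.r C (x 0)) (hpre : ∀ t ∈ Icc 0 τ, x t 2 ≤ C')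
    (h0 : ∀ t ∈ Icc 0 τ, (B.crudeBox G Rb h C C').mem G.κ G.r (x t))
    (hchain : B.PassChain G Rb h C C' K S) (hsides : ∀ j < K, (S j).Sides G) :
    ∀ j ≤ K, ∀ t ∈ Icc 0 τ, (S j).mem G.κ G.r (x t) := by
  intro j
  induction j with
  | zero => exact fun _ t ht => hchain.zero _ (h0 t ht)
  | succ j ih =>
    intro hj t ht
    have hjK : j < K := Nat.lt_of_succ_le hj
    exact hchain.succ j hjK _
      (hW.refine_valid hG hτh (ih hjK.le) (hsides j hjK) hB hpre t ht)

/-- **THE LEVEL WINDOW along a pass chain.** On a forced window of length `h ≥ 0` inside the open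
mode ball of radius `Rb`, entering level `C` in the entry box `B`: if the crude side conditions
hold, `S` is a pass chain of length `K` whose boxes satisfy the side conditions, and the final
trigger speed floor is positive and covers the gap (`C' - C ≤ ρℓ h`), then the trigger reaches
`C'` at a time `T ∈ [(C' - C)/ρh, min ((C' - C)/ρℓ) h]`, before which the final box `S K` holds.
[folklore] -/
theorem level_window_chain (hG : G.Valid) {h C C' Rb : ℝ} {B : LevelEntry} {K : ℕ}
    {S : ℕ → WindowBox}
    (hW : IsForcedWindow G.ε G.σ G.ν G.μ G.r G.κ G.δ h x) (hh : 0 ≤ h) (hRb : 0 ≤ Rb)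
    (hball : ∀ t ∈ Ico 0 h, ∀ i, |x t i| < Rb) (hB : B.mem G.κ G.r C (x 0))
    (hcs : B.CrudeSides G Rb h C C') (hchain : B.PassChain G Rb h C C' K S)
    (hsides : ∀ j ≤ K, (S j).Sides G)
    (hreach : C' - C ≤ (S K).ρℓ G * h) (hρ : 0 < (S K).ρℓ G) :
    ∃ T ∈ Icc 0 h, (C' - C) / (S K).ρh G ≤ T ∧
      T ≤ min ((C' - C) / (S K).ρℓ G) h ∧ x T 2 = C' ∧
      (∀ t ∈ Ico 0 T, ∀ i, |x t i| ≤ Rb) ∧ (∀ t ∈ Icc 0 T, x t 2 ≤ C') ∧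
      ∀ t ∈ Icc 0 T, (S K).mem G.κ G.r (x t) := by
  set SK := S K with hSK
  have hcont2 : ContinuousOn (fun s => x s 2) (Icc 0 h) :=
    (continuous_apply 2).comp_continuousOn hW.continuousOn
  have h02 : x 0 2 ≤ C' := by rw [hB.2.2.1]; exact hcs.hCC'
  set T := maximalTimeP (fun s => x s 2 ≤ C') 0 h with hT
  have hTmem : T ∈ Icc 0 h := maximalTimeP_le_const_mem hh h02
  have hpre : ∀ t ∈ Icc 0 T, x t 2 ≤ C' := fun t ht => maximalTimeP_le_const_spec hh hcont2 h02 ht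
  have hWT := hW.mono hTmem.2
  have hballT : ∀ t ∈ Ico 0 T, ∀ i, |x t i| ≤ Rb :=
    fun t ht i => (hball t ⟨ht.1, ht.2.trans_le hTmem.2⟩ i).le
  have hS0 := hWT.crude_valid hG hTmem.1 hTmem.2 hRb hballT hB hcs hpre
  have hSKv : ∀ t ∈ Icc 0 T, SK.mem G.κ G.r (x t) :=
    hWT.chain_valid hG hTmem.2 hB hpre hS0 hchain (fun j hj => hsides j hj.le) K le_rfl
  have henv := hWT.envelope_bounds hG hSKv (hsides K le_rfl) hB T ⟨hTmem.1, le_rfl⟩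
  obtain ⟨-, -, ⟨hcF, hcC⟩, -, -⟩ := henv
  have hcT : x T 2 = C' := by
    by_cases hlt : T < h
    · exact eq_of_maximalTimeP_le_const_lt hh hcont2 h02 hlt
    · have hTeq : T = h := le_antisymm hTmem.2 (not_lt.1 hlt)
      refine le_antisymm (hpre T ⟨hTmem.1, le_rfl⟩) ?_
      rw [hTeq] at hcF ⊢
      linarith
  refine ⟨T, hTmem, ?_, ?_, hcT, hballT, hpre, hSKv⟩
  · by_cases hρh : 0 < SK.ρh G
    · rw [div_le_iff₀ hρh]; linarith
    · push Not at hρh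
      have : SK.ρh G * T ≤ 0 := mul_nonpos_of_nonpos_of_nonneg hρh hTmem.1
      have hCC : C' - C = 0 := by linarith [hcs.hCC']
      rw [hCC, zero_div]; exact hTmem.1
  · refine le_min ?_ hTmem.2
    rw [le_div_iff₀ hρ]; linarith

/-- **THE LEVEL WINDOW** for the exact recursion `levelBox` (pass chain `passChain_levelBox`).
[folklore] -/
theorem level_window (hG : G.Valid) {h C C' Rb : ℝ} {B : LevelEntry} {K : ℕ}
    (hW : IsForcedWindow G.ε G.σ G.ν G.μ G.r G.κ G.δ h x) (hh : 0 ≤ h) (hRb : 0 ≤ Rb)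
    (hball : ∀ t ∈ Ico 0 h, ∀ i, |x t i| < Rb) (hB : B.mem G.κ G.r C (x 0))
    (hcs : B.CrudeSides G Rb h C C') (hsides : ∀ j ≤ K, (B.levelBox G Rb h C C' j).Sides G)
    (hreach : C' - C ≤ (B.levelBox G Rb h C C' K).ρℓ G * h)
    (hρ : 0 < (B.levelBox G Rb h C C' K).ρℓ G) :
    ∃ T ∈ Icc 0 h, (C' - C) / (B.levelBox G Rb h C C' K).ρh G ≤ T ∧
      T ≤ min ((C' - C) / (B.levelBox G Rb h C C' K).ρℓ G) h ∧ x T 2 = C' ∧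
      (∀ t ∈ Ico 0 T, ∀ i, |x t i| ≤ Rb) ∧ (∀ t ∈ Icc 0 T, x t 2 ≤ C') ∧
      ∀ t ∈ Icc 0 T, (B.levelBox G Rb h C C' K).mem G.κ G.r (x t) :=
  hW.level_window_chain hG hh hRb hball hB hcs (B.passChain_levelBox G Rb h C C' K) hsides
    hreach hρ

end IsForcedWindow

end Literature.Analysis.FluidPDE.FluidComputer

end
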